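import Literature.MathematicalPhysics.QuantumFieldTheory.Balaban1983to89.B8Prop6DentedCubeMemberGammaPrecompRec

/-!
# `Balaban1983to89.B8Prop6DentedCubeMemberGammaPrecompProp6Rec` — [Balaban1985RegularSpaces] Prop. 6 ∕ [Balaban1985Variational] (152)–(153) AT THE DENTED RECORD MEMBER FOR THE
# PRE-COMPOSED INPUT `(U₀″)^{h}`, γ edition, modulo the three existence bodies: the record twin of `B8Prop6DentedCubeMemberGammaRec.prop6_exists_dentedMember_at_γ₃` with the Theorem-4
# input `U₀″ ↦ (U₀″)^{h}` (`h` unitary, constant on the block towers under the dented cells, oscillation `ω`), threshold `L³α₀ + (6dL²Mα₀ + ω) ≤ c₁`, and (1.135)′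
# `U₀^{(v⁻¹h⁻¹u)⁻¹} = ((U₀″)^h)^{u⁻¹}` — item (B′-4)·3 of the plan's road (B′) for director-ym №310–№312a branch (ii) (pen dag-n05-e g41)

statement-level skeleton of published theorems with citation tags; proofs where landed; nothing here is a claim about the Yang–Mills mass gap

CITATION HEADER (lean-in-tree rule).  Cell `pub-ymgap` (HUMAN RULING D-0062), «N05-REC» road; (B′-4)·2 `B8Prop6DentedCubeMemberGammaPrecompRec.thm4_hypotheses_one_precomposed_dented_γ`
(the §1 package for `(U₀″)^h`) feeds the SAME γ driver `B8Thm4ExistsAtGammaRec.thm4Exists_concrete_at_γ`; the three existence bodies are taken at the datum `(1, (U₀″)^h)`; the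
constants read `α₀′ + α₁′` with `α₁′ := 6dL²Mα₀ + ω` (the letter `ω`, not `τ`, to avoid the bodies' bound direction variable).  The G5 → G8 crown twins (Gauged, Norms, Flat, Scalar, NamedFacts, SU25) on top of THIS file are the successor's generator run.
[6] = [Balaban1985RegularSpaces] Prop. 6 (1.134)–(1.136) p. 99, Thm 4 p. 88, Prop. 5 p. 94, (1.58)–(1.59) p. 86; [15] = [Balaban1985Variational] (148)–(153) p. 301; [I] = [Balaban1987RG1]
(0.3)–(0.4), (0.6) pp. 252–253.  `--kind proof --supports stmt-QuantumFields-20541` (K0⁷; count-neutral; no definition).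
REUSED BY NAME: everything `prop6_exists_dentedMember_at_γ₃` uses (`thm4Exists_concrete_at_γ`, `lamBPT_hbox_pred`, `lamBPT_hclass`, `bdryLayer_dented`, `hΩ_sq`, `lamST_top_apply`,
`localGaugeZ_mem`, `avgClosedZ_unitaryUnits`, `pdevOn_lt_of_inAk_box`, `agree135`, `mgauge_one_left`) + `B8Eq115GaugeFixing.gaugeAct_mul` + (B′-4)·2.

HONEST SCOPE.  A driver call with the pre-composed §1 package — NO new estimate, nothing of Theorem 4 ∕ Prop. 5 ∕ (1.59) proved (the three bodies are hypotheses, as in G4); branch (ii)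
licence line as ruled; `HThm4Rec*` CONDITIONAL; N05 DISCHARGED OF RECORD since R467 (count-neutral record-level work), N07 NOT discharged; counts unmoved (typed 28∕28 · discharged 8∕28);
one finite 𝕋⁴ programme at fixed ε, `G = SU(2)` of record — nothing continuum ∕ ℝ⁴ ∕ OS ∕ mass gap ∕ Clay.  No `def`, no `instance`, no `notation`, no `sorry`.
-/

set_option autoImplicit false

noncomputable section

namespace Literature.MathematicalPhysics.QuantumFieldTheory.Balaban1983to89.B8Prop6DentedCubeMemberGammaPrecompProp6Rec

open B7Prop1Explicit B7Prop2Explicit B7Prop1Local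
open B7Eq92Concrete (mgauge mgauge_apply mgauge_one_left)
open B7Prop2Explicit (c2' unitaryUnits unitaryUnits_le_U1)
open B7Prop2Rec (AvgClosedZ C0Z avgClosedZ_unitaryUnits)
open B7AvgGaugeCovariance (uLev)
open BlockAveragingZd (avgIterZ ctrShift)
open B7SectEFLinearisationRec (linCovIterZ)
open B8Ineq130Rec (tlo thi tlo_le_thi)
open B8Ineq132 (covDerivFwd InAk BondTouches condAt_anti)
open B8Ineq132Rec (pdevOn_lt_of_inAk_box)
open B8Ineq133Rec (cutFixedZ)
open B8Eq115GaugeFixing (gaugeAct_mul)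
open B8Eq115GaugeFixingRec (localGaugeZ)
open B8Eq119TwistedAxialRec (InAxZ Restr129Z UnderZ)
open B8Eq184Proof (gaugeExp cfgExp)
open B8Lemma1NonAbelian (mulCfg)
open B8Eq140Level (SideTouches)
open B8Eq146AExpansion (iEta)
open B8Eq155JBound (Jcur wsup)
open B8ScaledSupNorm (bondNorm msup)
open B8Eq138LandauZd (logCfg)
open B8Eq138LandauZdRec (IsLandau138WZ)
open B8Eq131Cubes (tLo tHi ctr tLo_le_tHi)
open B8Prop6OfThm4 (agree135)
open B8Prop6OfThm4Rec (localGaugeZ_mem)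
open B8Thm4ExistsAtGammaRec (thm4Exists_concrete_at_γ)
open B9SupplySockB9P3ZdBeta (CrossB)
open B8DentedCubeMemberZdRec (lamST_top_apply hΩ_sq lamBPT_hbox_pred lamBPT_hclass bdryLayer_dented)
open B8Prop6DentedCubeMemberGammaPrecompRec (thm4_hypotheses_one_precomposed_dented_γ)
open Node00 (CubeB8DZ)

export B7Prop1Explicit (Site)

variable {d : ℕ}
variable {𝔸 : Type} [CStarAlgebra 𝔸] [Nontrivial 𝔸]

/-- ★★★ **PROPOSITION 6 (p. 99) ∕ [15] (152)–(153) AT THE DENTED RECORD CUBE MEMBER FOR THE PRE-COMPOSED INPUT `(U₀″)^{h}`, MODULO THE THREE EXISTENCE BODIES AT THE DATUM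
`(1, (U₀″)^h)`, EDITION γ** — the statement of `B8Prop6DentedCubeMemberGammaRec.prop6_exists_dentedMember_at_γ₃` with: extra binders `h` (unitary), `X` (cell data: `h = X(j,y)` on the
block tower under every dented cell `y ∈ Λ′_j`, `1 ≤ j ≤ k`), `ω ≥ 0` (oscillation of `h` across the (1.35) bonds and the level-0 collar); threshold `L³α₀ + (6dL²Mα₀ + τ) ≤ c₁`; every
`α₁′ = 6dL²Mα₀` replaced by `6dL²Mα₀ + ω`; the datum `U₀″` replaced by `(U₀″)^h` in the three bodies and the conclusion; `w′ := v⁻¹·h⁻¹·u` unitary and (1.135)′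
`U₀^{w′⁻¹} = ((U₀″)^h)^{u⁻¹}` on `□̃`.  ONE threshold `c₁` (the γ driver's, the SAME as G4's).
[cite: Balaban1985RegularSpaces, Prop. 6 (1.135)–(1.136) p.99, p.99 (sentence after (1.133)), Thm 4 p.88 (existence), Prop. 5 (1.107)–(1.108) p.94, (1.58)–(1.59) p.86; Balaban1985Variational, (148)–(153) p.301; Balaban1987RG1, (0.4) p.253, (0.6) p.253] -/
theorem prop6_exists_dentedMember_precomposed_at_γ₃ (hd2 : 2 ≤ d) {L s : ℕ} (hLs : L = 2 * s + 1) (hs : 1 ≤ s) {B₀ B₀' Bbd : ℝ} (hB₀ : 0 < B₀) (hB₀' : 0 < B₀')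
    (hB : 2 ≤ 5 * (d : ℝ) * L * B₀) (hBbd : 0 ≤ Bbd) (hBd : 4 * Bbd ≤ ((d : ℝ) * L - 1) * B₀) :
    ∃ c₁ : ℝ, 0 < c₁ ∧ ∀ (η : ℝ), 0 < η → ∀ {K : ℕ} {Ω : ℕ → Set (Site d)} (c : CubeB8DZ d L K Ω),
      ∀ (U₀ : Site d → Fin d → 𝔸ˣ), (∀ x κ, U₀ x κ ∈ unitaryUnits 𝔸) → ∀ (α₀ : ℝ), 0 < α₀ →
      C0Z d * (α₀ * (L : ℝ) ^ 2) ≤ 1 / 3 → 2 * (α₀ * (L : ℝ) ^ 2) ≤ c2' d L →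
      InAk L c.k η α₀ Ω U₀ →
      11 * (d : ℝ) ^ 2 * (L : ℝ) ^ 2 * α₀ + ((c.M : ℝ) + 4 * c.ρ) * d * (L : ℝ) ^ 2 * α₀ ≤ 1 / 6 →
      -- the pre-composition `h`: unitary, constant under the dented cells, oscillation `ω`
      ∀ (h : Site d → 𝔸ˣ), (∀ x, h x ∈ unitaryUnits 𝔸) → ∀ (X : ℕ → Site d → 𝔸ˣ),
      (∀ j, 1 ≤ j → j ≤ c.k → ∀ y ∈ c.lamS j, ∀ x, UnderZ L j y x → h x = X j y) → ∀ (ω : ℝ), 0 ≤ ω →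
      (∀ j, j ≤ c.k → ∀ (z : Site d) (μ : Fin d),
        (∀ x, InBox (fun i => (L : ℤ) ^ j * z i - (ctrShift L j : ℤ)) (fun i => (L : ℤ) ^ j * z i + (ctrShift L j : ℤ) + if i = μ then (L : ℤ) ^ j else 0) x →
          x ∈ c.sq (j - 1)) → ‖((uLev L h j z : 𝔸ˣ) : 𝔸) - ((uLev L h j (z + e μ) : 𝔸ˣ) : 𝔸)‖ ≤ ω) →
      (∀ b ∈ {b : Site d × Fin d | SideTouches (c.sq 0) b.1 b.2}, ‖((h b.1 : 𝔸ˣ) : 𝔸) - ((h (b.1 + e b.2) : 𝔸ˣ) : 𝔸)‖ ≤ ω) →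
      (L : ℝ) ^ 3 * α₀ + (6 * d * (L : ℝ) ^ 2 * c.M * α₀ + ω) ≤ c₁ →
      ((∃ (v : Site d → 𝔸ˣ) (lam : Site d → 𝔸), (∀ x, v x ∈ unitaryUnits 𝔸) ∧ (∀ x, x ∉ c.sq 0 → v x = 1) ∧
        (∀ j, j ≤ 1 → ∀ b ∈ {b : Site d × Fin d | SideTouches (c.sq j) b.1 b.2}, (v b.1 : 𝔸) = ((gaugeExp lam b.1 : 𝔸ˣ) : 𝔸) ∧
        (v (b.1 + e b.2) : 𝔸) = ((gaugeExp lam (b.1 + e b.2) : 𝔸ˣ) : 𝔸)) ∧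
        (∀ j, j ≤ 1 → ∀ b ∈ {b : Site d × Fin d | SideTouches (c.sq j) b.1 b.2},
        ‖lam b.1‖ ≤ (8 * B₀' * (5 * (d : ℝ) * L * B₀) * (((L : ℝ) ^ 3 * α₀) + (6 * d * (L : ℝ) ^ 2 * c.M * α₀ + ω))) ∧
          ((L : ℝ) ^ j * η) * ‖covDerivFwd η (1 : Site d → Fin d →
          𝔸ˣ) b.2 lam b.1‖ ≤ (8 * B₀' * (5 * (d : ℝ) * L * B₀) * (((L : ℝ) ^ 3 * α₀) + (6 * d * (L : ℝ) ^ 2 * c.M * α₀ + ω)))) ∧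
        IsLandau138WZ L 1 η (c.sq 0) (c.lamST 1) (1 : Site d → Fin d → 𝔸ˣ) (mgauge (1 : Site d → Fin d →
          𝔸ˣ) v⁻¹ (gaugeAct h (cutFixedZ L (tLo c.a c.ρ) (tHi c.a c.M c.ρ) U₀ c.k (ctr c.a c.M)))) ∧ Restr129Z L 1 (c.lamST 1) (1 : Site d → Fin d → 𝔸ˣ) ((1 : Site d →
          𝔸ˣ) * v))) →
      ((∀ m, 1 ≤ m → m < c.k → ∀ (u₁ : Site d → 𝔸ˣ) (U₁ : Site d → Fin d → 𝔸ˣ) (A : Site d → Fin d → 𝔸),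
        (∀ x, u₁ x ∈ unitaryUnits 𝔸) → (∀ x, x ∉ c.sq 0 → u₁ x = 1) → mgauge (1 : Site d → Fin d →
          𝔸ˣ) u₁ U₁ = (gaugeAct h (cutFixedZ L (tLo c.a c.ρ) (tHi c.a c.M c.ρ) U₀ c.k (ctr c.a c.M))) → Restr129Z L m (c.lamST m) (1 : Site d → Fin d → 𝔸ˣ) u₁ →
        IsLandau138WZ L m η (c.sq 0) (c.lamST m) (1 : Site d → Fin d → 𝔸ˣ) U₁ →
        (∀ j, j ≤ m → ∀ b ∈ {b : Site d × Fin d | SideTouches (c.sq j) b.1 b.2},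
        U₁ b.1 b.2 = cfgExp η A b.1 b.2 ∧ IsSelfAdjoint (A b.1 b.2) ∧
          ‖A b.1 b.2‖ ≤ (5 * (d : ℝ) * L * B₀ * (((L : ℝ) ^ 3 * α₀) + (6 * d * (L : ℝ) ^ 2 * c.M * α₀ + ω))) * ((L : ℝ) ^ j * η)⁻¹) →
        ∃ (v : Site d → 𝔸ˣ) (lam : Site d → 𝔸), (∀ x, v x ∈ unitaryUnits 𝔸) ∧ (∀ x, x ∉ c.sq 0 → v x = 1) ∧
        (∀ j, j ≤ m + 1 →
          ∀ b ∈ {b : Site d × Fin d | SideTouches (c.sq j) b.1 b.2}, (v b.1 : 𝔸) = ((gaugeExp lam b.1 : 𝔸ˣ) : 𝔸) ∧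
        (v (b.1 + e b.2) : 𝔸) = ((gaugeExp lam (b.1 + e b.2) : 𝔸ˣ) : 𝔸)) ∧
        (∀ j, j ≤ m + 1 → ∀ b ∈ {b : Site d × Fin d | SideTouches (c.sq j) b.1 b.2},
        ‖lam b.1‖ ≤ (8 * B₀' * (5 * (d : ℝ) * L * B₀) * (((L : ℝ) ^ 3 * α₀) + (6 * d * (L : ℝ) ^ 2 * c.M * α₀ + ω))) ∧
          ((L : ℝ) ^ j * η) * ‖covDerivFwd η (1 : Site d → Fin d →
          𝔸ˣ) b.2 lam b.1‖ ≤ (8 * B₀' * (5 * (d : ℝ) * L * B₀) * (((L : ℝ) ^ 3 * α₀) + (6 * d * (L : ℝ) ^ 2 * c.M * α₀ + ω)))) ∧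
        IsLandau138WZ L (m + 1) η (c.sq 0) (c.lamST (m + 1)) (1 : Site d → Fin d → 𝔸ˣ) (mgauge (1 : Site d → Fin d →
          𝔸ˣ) v⁻¹ U₁) ∧ Restr129Z L (m + 1) (c.lamST (m + 1)) (1 : Site d → Fin d → 𝔸ˣ) (u₁ * v))) →
      ((∀ m, 1 ≤ m → m ≤ c.k → ∀ (u : Site d → 𝔸ˣ) (W : Site d → Fin d → 𝔸ˣ) (A' : Site d → Fin d → 𝔸),
        (∀ x, u x ∈ unitaryUnits 𝔸) → (∀ x, x ∉ c.sq 0 → u x = 1) →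
          mgauge (1 : Site d → Fin d → 𝔸ˣ) u W = (gaugeAct h (cutFixedZ L (tLo c.a c.ρ) (tHi c.a c.M c.ρ) U₀ c.k (ctr c.a c.M))) →
          Restr129Z L m (c.lamST m) (1 : Site d → Fin d → 𝔸ˣ) u →
          IsLandau138WZ L m η (c.sq 0) (c.lamST m) (1 : Site d → Fin d → 𝔸ˣ) W →
        (∀ y τ, IsSelfAdjoint (A' y τ)) →
        (∀ j, j ≤ m → ∀ y τ, SideTouches (c.sq j) y τ →
        W y τ = cfgExp η A' y τ ∧
          ‖A' y τ‖ ≤ (2 * (L * (5 * (d : ℝ) * L * B₀ * (((L : ℝ) ^ 3 * α₀) + (6 * d * (L : ℝ) ^ 2 * c.M * α₀ + ω)))) + 8 * (8 * B₀' * (5 * (d : ℝ) * L * B₀) * (((L : ℝ) ^ 3 * α₀) + (6 * d * (L : ℝ) ^ 2 * c.M * α₀ + ω)))) * ((L : ℝ) ^ j * η)⁻¹) →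
        (∀ y τ, (∀ j, j ≤ m → ¬ SideTouches (c.sq j) y τ) → A' y τ = 0) →
        msup L m η (-(1 : ℝ)) (fun j (b : Site d × Fin d) => SideTouches (c.sq j) b.1 b.2) (fun b => A' b.1 b.2)
        ≤ B₀ * (bondNorm L m η (-(3 : ℝ)) c.sq (fun x μ => Jcur η (1 : Site d → Fin d → 𝔸ˣ) A' μ x)
        + wsup 1 (fun p : {p : ℕ × (Site d × Fin d) // p.1 ≤ m ∧ (p.2 ∈ c.lamBPT m p.1 ∨ (p.1 = 0 ∧ CrossB (c.sq 0) p.2))} =>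
        linCovIterZ L (1 : Site d → Fin d → 𝔸ˣ) (iEta η A') p.1.1 p.1.2.1 p.1.2.2))
        + Bbd * msup L m η (-(1 : ℝ)) (fun j (b : Site d × Fin d) => j = 0 ∧ SideTouches (c.sq 0) b.1 b.2 ∧
            ¬ BondTouches (c.sq 0) b.1 b.2) (fun b => A' b.1 b.2) ∧
        msup L m η (-(2 : ℝ)) (fun j (t : Fin d × Fin d × Site d) => SideTouches (c.sq j) t.2.2 t.2.1)
        (fun t => covDerivFwd η (1 : Site d → Fin d → 𝔸ˣ) t.1 (fun z => A' z t.2.1) t.2.2)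
        ≤ B₀ * (bondNorm L m η (-(3 : ℝ)) c.sq (fun x μ => Jcur η (1 : Site d → Fin d → 𝔸ˣ) A' μ x)
        + wsup 1 (fun p : {p : ℕ × (Site d × Fin d) // p.1 ≤ m ∧ (p.2 ∈ c.lamBPT m p.1 ∨ (p.1 = 0 ∧ CrossB (c.sq 0) p.2))} =>
        linCovIterZ L (1 : Site d → Fin d → 𝔸ˣ) (iEta η A') p.1.1 p.1.2.1 p.1.2.2))
        + Bbd * msup L m η (-(1 : ℝ)) (fun j (b : Site d × Fin d) => j = 0 ∧ SideTouches (c.sq 0) b.1 b.2 ∧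
            ¬ BondTouches (c.sq 0) b.1 b.2) (fun b => A' b.1 b.2))) →
      ∃ u : Site d → 𝔸ˣ, (∀ x, u x ∈ unitaryUnits 𝔸) ∧ (∀ x, x ∉ c.sq 0 → u x = 1) ∧
        Restr129Z L c.k c.lamS (1 : Site d → Fin d → 𝔸ˣ) u ∧
        IsLandau138WZ L c.k η (c.sq 0) c.lamS (1 : Site d → Fin d → 𝔸ˣ)
          (gaugeAct u⁻¹ (gaugeAct h (cutFixedZ L (tLo c.a c.ρ) (tHi c.a c.M c.ρ) U₀ c.k (ctr c.a c.M)))) ∧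
        (∀ j, j ≤ c.k → ∀ b ∈ {b : Site d × Fin d | SideTouches (c.sq j) b.1 b.2},
          gaugeAct u⁻¹ (gaugeAct h (cutFixedZ L (tLo c.a c.ρ) (tHi c.a c.M c.ρ) U₀ c.k (ctr c.a c.M))) b.1 b.2 =
              cfgExp η (logCfg η (gaugeAct u⁻¹ (gaugeAct h (cutFixedZ L (tLo c.a c.ρ) (tHi c.a c.M c.ρ) U₀ c.k (ctr c.a c.M))))) b.1 b.2 ∧
            IsSelfAdjoint (logCfg η (gaugeAct u⁻¹ (gaugeAct h (cutFixedZ L (tLo c.a c.ρ) (tHi c.a c.M c.ρ) U₀ c.k (ctr c.a c.M)))) b.1 b.2) ∧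
            ‖logCfg η (gaugeAct u⁻¹ (gaugeAct h (cutFixedZ L (tLo c.a c.ρ) (tHi c.a c.M c.ρ) U₀ c.k (ctr c.a c.M)))) b.1 b.2‖ ≤
              (5 * (d : ℝ) * L * B₀ * ((L : ℝ) ^ 3 * α₀ + (6 * d * (L : ℝ) ^ 2 * c.M * α₀ + ω))) * ((L : ℝ) ^ j * η)⁻¹) ∧
        (∀ x, ((localGaugeZ L (tLo c.a c.ρ) (tHi c.a c.M c.ρ) U₀ c.k (ctr c.a c.M))⁻¹ * (h⁻¹ * u)) x ∈ unitaryUnits 𝔸) ∧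
        AgreeOn (B8Ineq130Rec.tlo L (tLo c.a c.ρ) c.k) (B8Ineq130Rec.thi L (tHi c.a c.M c.ρ) c.k)
          (gaugeAct ((localGaugeZ L (tLo c.a c.ρ) (tHi c.a c.M c.ρ) U₀ c.k (ctr c.a c.M))⁻¹ * (h⁻¹ * u))⁻¹ U₀)
          (gaugeAct u⁻¹ (gaugeAct h (cutFixedZ L (tLo c.a c.ρ) (tHi c.a c.M c.ρ) U₀ c.k (ctr c.a c.M)))) := by
  have hL1 : 1 ≤ L := by omega
  have hL : 2 ≤ L := by omega
  have hLo : Odd L := ⟨s, hLs⟩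
  have hd1 : 1 ≤ d := le_trans (by norm_num) hd2
  obtain ⟨c₁, hc₁, H⟩ := thm4Exists_concrete_at_γ (𝔸 := 𝔸) hd2 hLs hs hB₀ hB₀' hB hBbd hBd
  refine ⟨c₁, hc₁, ?_⟩
  intro η hη K Ω c U₀ hU₀ α₀ hα hα3 hα2 hA hsmall h hh X hconst ω hω hoscj hosc0 hc P5base₁ P5step₁ H59Dβ₁
  have hk : 1 ≤ c.k := c.one_le_k
  have hρ : 1 ≤ c.ρ := hL1.trans c.L_le_ρ
  have hM1 : 1 ≤ c.M := hρ.trans c.ρ_le_M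
  have hLpos : (0 : ℝ) < L := by exact_mod_cast lt_of_lt_of_le (by norm_num) hL
  have hdpos : (0 : ℝ) < d := by exact_mod_cast hd1
  have hMpos : (0 : ℝ) < c.M := by exact_mod_cast hM1
  have hα₀' : 0 < (L : ℝ) ^ 3 * α₀ := by positivity
  have hα₁' : 0 < 6 * (d : ℝ) * (L : ℝ) ^ 2 * c.M * α₀ + ω := by positivity
  obtain ⟨hmem, h33, h34, hAx, h135, h66⟩ :=
    thm4_hypotheses_one_precomposed_dented_γ hLs hs hd1 c U₀ hU₀ hα hα3 hα2 hη hA hsmall h hh X hconst hoscj hosc0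
  have hone : ∀ x κ, (1 : Site d → Fin d → 𝔸ˣ) x κ ∈ unitaryUnits 𝔸 := fun _ _ => (unitaryUnits 𝔸).one_mem
  obtain ⟨u, hu, huS, h129, hLan, h162⟩ := H η hη c.k c.sq (hΩ_sq c hLo) c.lamST c.lamBPT (lamBPT_hbox_pred c hLs) (lamBPT_hclass c hLs)
    (bdryLayer_dented c hLs hs) _ _ hα₀' hα₁' hc 1 _ hone hmem h33 h34 hAx h135 h66 P5base₁ P5step₁ H59Dβ₁
  simp only [mgauge_one_left] at hLan h162
  have htop : c.lamST c.k = c.lamS := funext (lamST_top_apply c)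
  rw [htop] at h129 hLan
  have hΩ' : ∃ l, l ≤ c.k ∧ c.k ≤ l + 1 ∧ ∀ x, InBox (B8Ineq130Rec.tlo L (tLo c.a c.ρ) c.k) (B8Ineq130Rec.thi L (tHi c.a c.M c.ρ) c.k) x → x ∈ Ω l :=
    ⟨c.k - 1, Nat.sub_le _ _, by omega, fun x hx => c.tcube_sub hx⟩
  have hvG : ∀ x, localGaugeZ L (tLo c.a c.ρ) (tHi c.a c.M c.ρ) U₀ c.k (ctr c.a c.M) x ∈ unitaryUnits 𝔸 :=
    localGaugeZ_mem hLs hL (avgClosedZ_unitaryUnits (𝔸 := 𝔸) d L) c.k U₀ hU₀ hα hα3 hα2 (tLo_le_tHi hM1)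
      (pdevOn_lt_of_inAk_box hL1 hα hA hΩ') (ctr c.a c.M)
  -- (1.135)′: `U₀^{(v⁻¹h⁻¹u)⁻¹} = ((U₀″)^h)^{u⁻¹}` on `□̃`
  have h135' := agree135 (B8Ineq130Rec.tlo L (tLo c.a c.ρ) c.k) (B8Ineq130Rec.thi L (tHi c.a c.M c.ρ) c.k) U₀
    (localGaugeZ L (tLo c.a c.ρ) (tHi c.a c.M c.ρ) U₀ c.k (ctr c.a c.M)) (h⁻¹ * u)
  have hmul : gaugeAct (h⁻¹ * u)⁻¹ (cutFixedZ L (tLo c.a c.ρ) (tHi c.a c.M c.ρ) U₀ c.k (ctr c.a c.M)) =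
      gaugeAct u⁻¹ (gaugeAct h (cutFixedZ L (tLo c.a c.ρ) (tHi c.a c.M c.ρ) U₀ c.k (ctr c.a c.M))) := by
    rw [mul_inv_rev, inv_inv, gaugeAct_mul]
  rw [hmul] at h135'
  exact ⟨u, hu, huS, h129, hLan hk, h162,
    fun x => (unitaryUnits 𝔸).mul_mem ((unitaryUnits 𝔸).inv_mem (hvG x)) ((unitaryUnits 𝔸).mul_mem ((unitaryUnits 𝔸).inv_mem (hh x)) (hu x)),
    h135'⟩

end Literature.MathematicalPhysics.QuantumFieldTheory.Balaban1983to89.B8Prop6DentedCubeMemberGammaPrecompProp6Rec
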